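import Mathlib
import Summits.ResolutionOfSingularities.ResolutionOfSingularities.Theorems.HomologicalConductorPersistenceCyclicQuotientCharFreeHerzog
import Summits.ResolutionOfSingularities.ResolutionOfSingularities.Theorems.HomologicalConductorPersistenceAddCoverFamily
import HarnessLib

/-!
# Rung S-2 `PersistenceSurface` (stmt-19970), stub C1 (`Sat₄`) — the WEIGHT PIECES of `k[u,v]` over
# `U = k[u,v]^{(n;1,q)}` in EVERY CHARACTERISTIC: support criterion, finite generation, and the splitting
# `k[u,v]|_U ≅ Π_a V_a` (char-free port of parts 18–19; seat leafhand-res-homologicalconduct-13 gen 1)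

[OURS · cell decomp-res · rung S-2] Nothing here is a statement of the manuscript under review (Hironaka 2017);
AI-written, weaker than expert review.

Parts 18–19 (`…CyclicQuotientIsotypic`, `…CyclicQuotientIsotypicPieces`) split `k[u,v]|_U ≅ Π_a M_a` into the
`σ₀`-eigen-pieces through a primitive `n`-th root of unity `ζ ∈ k` (so `n ∈ kˣ`).  The rung quantifies over every
characteristic, and the engines meet cyclic arrivals `1/n(1,q)` with `p = char k ∣ n` (part `…CyclicQuotientCharFree`:
the SAME monomial algebra `U = k[uⁱvʲ : n ∣ i + qj]`, graded by `deg uⁱvʲ = i + qj ∈ ZMod n` — Mathlib's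
`weightedHomogeneousComponent` with weights `(1, q)`).  This file is the char-free dictionary the staircase machinery
needs, with the pieces described by `p ∈ M a ↔ weightedHomogeneousComponent (1,q) a p = p`:

* `weight_eq` — the weight of `u^{d₀}v^{d₁}` is `d₀ + q d₁ (mod n)`; **`whc_eq_self_iff`** — `p` lies in the piece
  `a` iff every monomial of its support has weight `a` (the support criterion replacing `rootAut_eq_C_mul_iff`);
  `whc_monomial`, `whc_mul`, **`whc_of_monomial_mul`** (dividing a homogeneous polynomial by a monomial shifts the
  weight), `whc_zero_monomial_of_dvd` (`u^{na}v^{nb}` has weight `0`).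
* `monomial_mem_piece`, **`finite_pieces`** — `M_a` is the `U`-span of the `≤ n²` monomials `uⁱvʲ`, `i, j < n`,
  `i + qj ≡ a`; hence every piece is finitely generated over `U`.
* **`exists_graded_splitting`** — the weight pieces as `U`-submodules `M a ⊆ k[u,v]|_U` together with a `U`-linear
  isomorphism `k[u,v]|_U ≅ Π a, M a` (projectors = weighted homogeneous components, part
  `…CyclicQuotientCharFree.exists_grading`).

No root of unity, no `n ∈ kˣ`, `k` any field.  No crux, kill test or summit statement is proved here.

References: folklore (gradings by a finite abelian group); Iyengar–Takahashi, IMRN 2016, arXiv:1404.1476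
[`IyengarTakahashi2014`] (vocabulary only).
-/

-- single-problem summit: the doubled namespace component `ResolutionOfSingularities` is forced
set_option linter.dupNamespace false

noncomputable section

open CategoryTheory MvPolynomial Literature.RingTheory.CohomologyAnnihilator
open Summit.ResolutionOfSingularities.ResolutionOfSingularities.Theorems.HomologicalConductor.PersistenceCyclicQuotientCharFree

universe u

namespace Summit.ResolutionOfSingularities.ResolutionOfSingularities.Theorems.HomologicalConductor.PersistenceCyclicQuotientGradedPieces

variable {k : Type u} [Field k] {n : ℕ} (q : ℕ)

/-! ## Weights and the support criterion -/

/-- The weight of the exponent `d = (d₀, d₁)` for the weights `(1, q)` in `ZMod n` is `d₀ + q d₁`. [folklore] -/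
theorem weight_eq (d : Fin 2 →₀ ℕ) :
    Finsupp.weight (![1, (q : ZMod n)] : Fin 2 → ZMod n) d = ((d 0 + q * d 1 : ℕ) : ZMod n) := by
  rw [Finsupp.weight_apply, Finsupp.sum_fintype _ _ (fun i => by simp)]
  simp only [Fin.sum_univ_two, Matrix.cons_val_zero, Matrix.cons_val_one, nsmul_eq_mul]
  push_cast
  ring

/-- **Support criterion**: `p` is its own weight-`a` component iff every monomial in its support has weight `a`.
[folklore] -/
theorem whc_eq_self_iff (a : ZMod n) (p : MvPolynomial (Fin 2) k) :
    weightedHomogeneousComponent (![1, (q : ZMod n)] : Fin 2 → ZMod n) a p = p ↔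
      ∀ d ∈ p.support, ((d 0 + q * d 1 : ℕ) : ZMod n) = a := by
  constructor
  · intro h d hd
    have hw : IsWeightedHomogeneous (![1, (q : ZMod n)] : Fin 2 → ZMod n) p a := by
      rw [← h]; exact weightedHomogeneousComponent_isWeightedHomogeneous a p
    rw [← weight_eq]
    exact hw (mem_support_iff.mp hd)
  · intro h
    apply weightedHomogeneousComponent_eq_self
    intro d hd
    rw [weight_eq]
    exact h d (mem_support_iff.mpr hd)

/-- A monomial is its own component in its weight. [folklore] -/
theorem whc_monomial (d : Fin 2 →₀ ℕ) (c : k) :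
    weightedHomogeneousComponent (![1, (q : ZMod n)] : Fin 2 → ZMod n) ((d 0 + q * d 1 : ℕ) : ZMod n) (monomial d c) =
      monomial d c :=
  weightedHomogeneousComponent_eq_self (isWeightedHomogeneous_monomial _ d c (weight_eq q d))

/-- **Dividing by a monomial shifts the weight**: if `u^{d₀}v^{d₁} · p` lies in the piece `x` then `p` lies in the
piece `x − (d₀ + q d₁)`. [folklore] -/
theorem whc_of_monomial_mul (d : Fin 2 →₀ ℕ) (x : ZMod n) (p : MvPolynomial (Fin 2) k)
    (h : weightedHomogeneousComponent (![1, (q : ZMod n)] : Fin 2 → ZMod n) x (monomial d 1 * p) = monomial d 1 * p) :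
    weightedHomogeneousComponent (![1, (q : ZMod n)] : Fin 2 → ZMod n) (x - ((d 0 + q * d 1 : ℕ) : ZMod n)) p = p := by
  rw [whc_eq_self_iff] at h ⊢
  intro d' hd'
  have hmem : d + d' ∈ (monomial d (1 : k) * p).support := by
    rw [mem_support_iff, coeff_monomial_mul, one_mul]; exact mem_support_iff.mp hd'
  rw [← h (d + d') hmem]
  push_cast [Finsupp.add_apply]
  ring

variable [NeZero n]

/-- Product rule: pieces multiply additively in the weight. [folklore] -/
theorem whc_mul (x y : ZMod n) (v w : MvPolynomial (Fin 2) k)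
    (hv : weightedHomogeneousComponent (![1, (q : ZMod n)] : Fin 2 → ZMod n) x v = v)
    (hw : weightedHomogeneousComponent (![1, (q : ZMod n)] : Fin 2 → ZMod n) y w = w) :
    weightedHomogeneousComponent (![1, (q : ZMod n)] : Fin 2 → ZMod n) (x + y) (v * w) = v * w :=
  (weightedHomogeneousComponent_grading (k := k) (n := n) q).2.2.1 x y v w hv hw

/-- The shift read the other way: `p` in the piece `ψ` and `ψ + wt(e) = 0` ⇒ `u^{e₀}v^{e₁} · p` has weight `0`.
[folklore] -/
theorem whc_zero_monomial_mul (ψ : ZMod n) (e : Fin 2 →₀ ℕ) (he : ψ + ((e 0 + q * e 1 : ℕ) : ZMod n) = 0)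
    (p : MvPolynomial (Fin 2) k)
    (hp : weightedHomogeneousComponent (![1, (q : ZMod n)] : Fin 2 → ZMod n) ψ p = p) :
    weightedHomogeneousComponent (![1, (q : ZMod n)] : Fin 2 → ZMod n) 0 (monomial e 1 * p) = monomial e 1 * p := by
  have h := whc_mul q (((e 0 + q * e 1 : ℕ) : ZMod n)) ψ (monomial e 1) p (whc_monomial q e 1) hp
  rwa [add_comm, he] at h

variable (U : Subalgebra k (MvPolynomial (Fin 2) k))
variable (hU : ∀ p, p ∈ U ↔ weightedHomogeneousComponent (![1, (q : ZMod n)] : Fin 2 → ZMod n) 0 p = p)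

omit [NeZero n] in
/-- A monomial all of whose exponents are multiples of `n` has weight `0` (so lies in `U`). [folklore] -/
theorem whc_zero_monomial_of_dvd (d : Fin 2 →₀ ℕ) (c : k) (h0 : n ∣ d 0) (h1 : n ∣ d 1) :
    weightedHomogeneousComponent (![1, (q : ZMod n)] : Fin 2 → ZMod n) 0 (monomial d c) = monomial d c := by
  have h := whc_monomial (n := n) q d c
  have hz : ((d 0 + q * d 1 : ℕ) : ZMod n) = 0 := by
    rw [ZMod.natCast_eq_zero_iff]; exact dvd_add h0 (dvd_mul_of_dvd_right h1 _)
  rwa [hz] at h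

/-! ## The pieces are finitely generated over `U` -/

section Pieces

variable (M : ZMod n → Submodule U ((restrictScalarsFunctor U (MvPolynomial (Fin 2) k)).obj
  (ModuleCat.of (MvPolynomial (Fin 2) k) (MvPolynomial (Fin 2) k))))
variable (hM : ∀ (a : ZMod n) (p : MvPolynomial (Fin 2) k),
  (show ((restrictScalarsFunctor U (MvPolynomial (Fin 2) k)).obj
    (ModuleCat.of (MvPolynomial (Fin 2) k) (MvPolynomial (Fin 2) k))) from p) ∈ M a ↔
  weightedHomogeneousComponent (![1, (q : ZMod n)] : Fin 2 → ZMod n) a p = p)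

omit [NeZero n] in
include hM in
/-- **Monomials lie in their weight piece**: `u^{d₀}v^{d₁}` (times a constant) lies in `M_{d₀ + q d₁}`. [folklore] -/
theorem monomial_mem_piece (d : Fin 2 →₀ ℕ) (c : k) :
    (show ((restrictScalarsFunctor U (MvPolynomial (Fin 2) k)).obj
      (ModuleCat.of (MvPolynomial (Fin 2) k) (MvPolynomial (Fin 2) k))) from monomial d c) ∈
      M (Finsupp.weight (![1, (q : ZMod n)] : Fin 2 → ZMod n) d) := by
  rw [hM, weight_eq]
  exact whc_monomial q d c

include hU hM in
/-- **Every weight piece `M_a` is a finitely generated `U`-module** — generated by the `≤ n²` monomials `uⁱvʲ`,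
`i, j < n`, `i + qj ≡ a` (write `u^{d₀}v^{d₁} = (u^{n⌊d₀/n⌋}v^{n⌊d₁/n⌋}) · u^{d₀ mod n}v^{d₁ mod n}`, the first factor of
weight `0`). [folklore] -/
theorem finite_pieces : ∀ a : ZMod n, Module.Finite U (M a) := by
  classical
  intro a
  -- generation by the small monomials of class `a`
  have hle : M a ≤ Submodule.span U ((fun ij : ℕ × ℕ => (show ((restrictScalarsFunctor U (MvPolynomial (Fin 2) k)).obj
        (ModuleCat.of (MvPolynomial (Fin 2) k) (MvPolynomial (Fin 2) k))) from
          monomial (Finsupp.single 0 ij.1 + Finsupp.single 1 ij.2) 1)) ''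
      ↑((Finset.range n ×ˢ Finset.range n).filter fun ij => ((ij.1 + q * ij.2 : ℕ) : ZMod n) = a)) := by
    intro w hw
    let toWh : MvPolynomial (Fin 2) k →+ ((restrictScalarsFunctor U (MvPolynomial (Fin 2) k)).obj
        (ModuleCat.of (MvPolynomial (Fin 2) k) (MvPolynomial (Fin 2) k))) :=
      { toFun := fun p => p, map_zero' := rfl, map_add' := fun _ _ => rfl }
    let ofW : ((restrictScalarsFunctor U (MvPolynomial (Fin 2) k)).obj
        (ModuleCat.of (MvPolynomial (Fin 2) k) (MvPolynomial (Fin 2) k))) → MvPolynomial (Fin 2) k := fun w => w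
    have hsupp : ∀ d ∈ (ofW w).support, ((d 0 + q * d 1 : ℕ) : ZMod n) = a :=
      (whc_eq_self_iff q a (ofW w)).mp ((hM a (ofW w)).mp hw)
    have hnpos : 0 < n := Nat.pos_of_ne_zero (NeZero.ne n)
    have hw' : w = toWh (∑ d ∈ (ofW w).support, monomial d (coeff d (ofW w))) :=
      congr_arg toWh (ofW w).as_sum
    rw [hw', map_sum]
    refine Submodule.sum_mem _ fun d hd => ?_
    let e : Fin 2 →₀ ℕ := Finsupp.single 0 (n * (d 0 / n)) + Finsupp.single 1 (n * (d 1 / n))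
    have heU : monomial e (coeff d (ofW w)) ∈ U :=
      (hU _).mpr (whc_zero_monomial_of_dvd q e _ (by simp [e]) (by simp [e]))
    have hexp : e + (Finsupp.single 0 (d 0 % n) + Finsupp.single 1 (d 1 % n)) = d := by
      ext i; fin_cases i <;> simp [e, Nat.div_add_mod]
    have hdecomp : toWh (monomial d (coeff d (ofW w))) = (⟨monomial e (coeff d (ofW w)), heU⟩ : U) •
        toWh (monomial (Finsupp.single 0 (d 0 % n) + Finsupp.single 1 (d 1 % n)) 1) := by
      change monomial d (coeff d (ofW w)) =
        monomial e (coeff d (ofW w)) * monomial (Finsupp.single 0 (d 0 % n) + Finsupp.single 1 (d 1 % n)) 1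
      rw [monomial_mul, mul_one, hexp]
    rw [hdecomp]
    refine Submodule.smul_mem _ _ (Submodule.subset_span ⟨(d 0 % n, d 1 % n), ?_, rfl⟩)
    rw [Finset.mem_coe, Finset.mem_filter]
    refine ⟨by simp [Nat.mod_lt _ hnpos], ?_⟩
    rw [← hsupp d hd]
    push_cast
    have h0 : ((d 0 : ℕ) : ZMod n) = ((d 0 % n : ℕ) : ZMod n) := by
      rw [ZMod.natCast_eq_natCast_iff]; exact (Nat.mod_modEq _ _).symm
    have h1 : ((d 1 : ℕ) : ZMod n) = ((d 1 % n : ℕ) : ZMod n) := by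
      rw [ZMod.natCast_eq_natCast_iff]; exact (Nat.mod_modEq _ _).symm
    rw [h0, h1]
  have hge : Submodule.span U ((fun ij : ℕ × ℕ => (show ((restrictScalarsFunctor U (MvPolynomial (Fin 2) k)).obj
        (ModuleCat.of (MvPolynomial (Fin 2) k) (MvPolynomial (Fin 2) k))) from
          monomial (Finsupp.single 0 ij.1 + Finsupp.single 1 ij.2) 1)) ''
      ↑((Finset.range n ×ˢ Finset.range n).filter fun ij => ((ij.1 + q * ij.2 : ℕ) : ZMod n) = a)) ≤ M a := by
    refine Submodule.span_le.mpr ?_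
    rintro _ ⟨ij, hij, rfl⟩
    rw [Finset.mem_coe, Finset.mem_filter] at hij
    have h := monomial_mem_piece q U M hM (Finsupp.single 0 ij.1 + Finsupp.single 1 ij.2) 1
    have hwt : Finsupp.weight (![1, (q : ZMod n)] : Fin 2 → ZMod n)
        (Finsupp.single 0 ij.1 + Finsupp.single 1 ij.2 : Fin 2 →₀ ℕ) = a := by
      rw [weight_eq, ← hij.2]; simp
    rw [hwt] at h
    exact h
  rw [Module.Finite.iff_fg, le_antisymm hle hge]
  exact Submodule.fg_span ((Finset.finite_toSet _).image _)
end Pieces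

/-! ## The splitting `k[u,v]|_U ≅ Π_a M_a` -/

include hU in
/-- **THE GRADED SPLITTING `k[u,v]|_U ≅ Π_a M_a` over `U = k[u,v]^{(n;1,q)}`, every characteristic.**  There are
`U`-submodules `M a` of `k[u,v]|_U` (`a : ZMod n`) with `p ∈ M a ↔ weightedHomogeneousComponent (1,q) a p = p` (the
weight pieces; `M 0 = U`) and a `U`-linear isomorphism `k[u,v]|_U ≅ Π a, M a` (`p ↦ (p_a)_a`, inverse = summation).
[folklore; OURS · cell decomp-res] -/
theorem exists_graded_splitting :
    ∃ M : ZMod n → Submodule U ((restrictScalarsFunctor U (MvPolynomial (Fin 2) k)).obj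
        (ModuleCat.of (MvPolynomial (Fin 2) k) (MvPolynomial (Fin 2) k))),
      (∀ (a : ZMod n) (p : MvPolynomial (Fin 2) k),
        (show ((restrictScalarsFunctor U (MvPolynomial (Fin 2) k)).obj
          (ModuleCat.of (MvPolynomial (Fin 2) k) (MvPolynomial (Fin 2) k))) from p) ∈ M a ↔
        weightedHomogeneousComponent (![1, (q : ZMod n)] : Fin 2 → ZMod n) a p = p) ∧
      Nonempty ((restrictScalarsFunctor U (MvPolynomial (Fin 2) k)).obj
          (ModuleCat.of (MvPolynomial (Fin 2) k) (MvPolynomial (Fin 2) k)) ≅ ModuleCat.of U (Π a, M a)) := by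
  classical
  obtain ⟨e, -, he, hsum, hproj, -, -, -, -⟩ := exists_grading (k := k) (n := n) q U hU
  let toW : MvPolynomial (Fin 2) k → ((restrictScalarsFunctor U (MvPolynomial (Fin 2) k)).obj
      (ModuleCat.of (MvPolynomial (Fin 2) k) (MvPolynomial (Fin 2) k))) := fun v => v
  let ofW : ((restrictScalarsFunctor U (MvPolynomial (Fin 2) k)).obj
      (ModuleCat.of (MvPolynomial (Fin 2) k) (MvPolynomial (Fin 2) k))) → MvPolynomial (Fin 2) k := fun w => w
  let M : ZMod n → Submodule U ((restrictScalarsFunctor U (MvPolynomial (Fin 2) k)).obj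
      (ModuleCat.of (MvPolynomial (Fin 2) k) (MvPolynomial (Fin 2) k))) := fun x =>
    { carrier := {w | e x (ofW w) = ofW w}
      add_mem' := fun {w w'} hw hw' => by
        change e x (ofW w + ofW w') = ofW w + ofW w'
        rw [map_add, hw, hw']
      zero_mem' := by
        change e x 0 = 0
        rw [map_zero]
      smul_mem' := fun c {w} hw => by
        change e x (algebraMap U (MvPolynomial (Fin 2) k) c * ofW w) = algebraMap U (MvPolynomial (Fin 2) k) c * ofW w
        rw [← Algebra.smul_def, map_smul, hw] }
  have hMx : ∀ x w, w ∈ M x ↔ e x (ofW w) = ofW w := fun _ _ => Iff.rfl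
  -- the projector into `M x`
  let π : (x : ZMod n) → ((restrictScalarsFunctor U (MvPolynomial (Fin 2) k)).obj
      (ModuleCat.of (MvPolynomial (Fin 2) k) (MvPolynomial (Fin 2) k))) →ₗ[U] M x := fun x =>
    { toFun := fun w => ⟨toW (e x (ofW w)), by
          change e x (e x (ofW w)) = e x (ofW w)
          rw [hproj, if_pos rfl]⟩
      map_add' := fun w w' => by
        apply Subtype.ext
        change e x (ofW w + ofW w') = e x (ofW w) + e x (ofW w')
        rw [map_add]
      map_smul' := fun c w => by
        apply Subtype.ext
        change e x (algebraMap U (MvPolynomial (Fin 2) k) c * ofW w) =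
          algebraMap U (MvPolynomial (Fin 2) k) c * e x (ofW w)
        rw [← Algebra.smul_def, map_smul, Algebra.smul_def] }
  have π_val : ∀ x w, ofW ((π x w : M x) : ((restrictScalarsFunctor U (MvPolynomial (Fin 2) k)).obj
      (ModuleCat.of (MvPolynomial (Fin 2) k) (MvPolynomial (Fin 2) k)))) = e x (ofW w) := fun _ _ => rfl
  let Φ : ((restrictScalarsFunctor U (MvPolynomial (Fin 2) k)).obj
      (ModuleCat.of (MvPolynomial (Fin 2) k) (MvPolynomial (Fin 2) k))) →ₗ[U] (Π x, M x) := LinearMap.pi π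
  have Φ_apply : ∀ w x, Φ w x = π x w := fun _ _ => rfl
  let ofWh : ((restrictScalarsFunctor U (MvPolynomial (Fin 2) k)).obj
      (ModuleCat.of (MvPolynomial (Fin 2) k) (MvPolynomial (Fin 2) k))) →+ MvPolynomial (Fin 2) k :=
    { toFun := ofW, map_zero' := rfl, map_add' := fun _ _ => rfl }
  have ofWh_apply : ∀ w, ofWh w = ofW w := fun _ => rfl
  have ofW_inj : Function.Injective ofW := fun _ _ h => h
  -- `∑_x π_x = id`
  have hsum' : ∀ w : ((restrictScalarsFunctor U (MvPolynomial (Fin 2) k)).obj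
      (ModuleCat.of (MvPolynomial (Fin 2) k) (MvPolynomial (Fin 2) k))),
      (∑ x, ((π x w : M x) : ((restrictScalarsFunctor U (MvPolynomial (Fin 2) k)).obj
        (ModuleCat.of (MvPolynomial (Fin 2) k) (MvPolynomial (Fin 2) k))))) = w := by
    intro w
    apply ofW_inj
    rw [← ofWh_apply, map_sum]
    simp only [ofWh_apply, π_val]
    exact hsum (ofW w)
  -- `π_x` on `M_y`
  have hπ : ∀ (x y : ZMod n) (m : M y), ofW (((π x (m : ((restrictScalarsFunctor U (MvPolynomial (Fin 2) k)).obj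
      (ModuleCat.of (MvPolynomial (Fin 2) k) (MvPolynomial (Fin 2) k))))) : M x) :
        ((restrictScalarsFunctor U (MvPolynomial (Fin 2) k)).obj
          (ModuleCat.of (MvPolynomial (Fin 2) k) (MvPolynomial (Fin 2) k)))) =
      if x = y then ofW (m : ((restrictScalarsFunctor U (MvPolynomial (Fin 2) k)).obj
        (ModuleCat.of (MvPolynomial (Fin 2) k) (MvPolynomial (Fin 2) k)))) else 0 := by
    intro x y m
    have hm : e y (ofW (m : _)) = ofW (m : _) := (hMx y _).mp m.2
    rw [π_val, ← hm, hproj]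
  have hΦinj : Function.Injective Φ := by
    intro w w' h
    rw [← hsum' w, ← hsum' w']
    exact Finset.sum_congr rfl fun x _ => by rw [← Φ_apply, ← Φ_apply, h]
  have hΦsurj : Function.Surjective Φ := by
    intro f
    refine ⟨∑ y, ((f y : M y) : ((restrictScalarsFunctor U (MvPolynomial (Fin 2) k)).obj
      (ModuleCat.of (MvPolynomial (Fin 2) k) (MvPolynomial (Fin 2) k)))), ?_⟩
    funext x
    rw [Φ_apply, map_sum]
    apply Subtype.ext
    apply ofW_inj
    rw [Submodule.coe_sum, ← ofWh_apply, map_sum]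
    simp only [ofWh_apply, hπ]
    rw [Finset.sum_ite_eq, if_pos (Finset.mem_univ _)]
  refine ⟨M, fun x p => (hMx x (toW p)).trans (by rw [he]), ⟨(LinearEquiv.ofBijective Φ ⟨hΦinj, hΦsurj⟩).toModuleIso⟩⟩

end Summit.ResolutionOfSingularities.ResolutionOfSingularities.Theorems.HomologicalConductor.PersistenceCyclicQuotientGradedPieces

end
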